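/-
Copyright (c) 2026 the pub-hodgecm-mathlib formalisation cell (harness21).  Prover seat hodgecm-mathlib-LH10-p02 (g14), 2026-09-03.  E1 row 55 «HOROCYCLE ∕ HEIGHT
GEOMETRY OF THE U(3) TREE AT THE DATUM», file A-I-2 «HOROCYCLE STEPS: THE TYPE-TWO STAR» (keeper F0P3a-p03 (g30) 03:20:54Z; census `CENSUS-R55.v1` c3e3dfd81a9bbf59).
-/
import Literature.NumberTheory.Automorphic.UnitaryLatticeTreeHorocycleRootStar      -- A-I-1 (this seat): §0 bookkeeping, (T), (T′), (H2); brings ★ 39γ, ★ V2a, ★ V3, ★ `unipotentU`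
import HarnessLib

/-!
# Horocycle steps of the unramified `U(3)` tree, II: the TYPE-TWO STAR as one horocycle step — `star(A (−1)) = {A (−2)} ⊔ (N ∩ Stab(A (−1))) · A 0`
# (Bruhat–Tits 1972 §10, (4.4.4); Serre, *Trees* II.1.1; Rogawski 1990 §1.10)

THE SETTING (common to the three files A-I-1∕2∕3).  `K` a valued field, `σ` an isometric involution, `ϖ` a `σ`-fixed uniformiser (`hd`), `J₀ = antidiag(1,1,1)`, `U = U(σ, J₀)`
acting on the lattice tree by ★ `latticeGraphIso`; `B ≥ T, N` the upper-triangular Borel subgroup of `U`, its diagonal torus and its unipotent radical (★ `UnitaryGroup.borelU ∕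
torusU ∕ unipotentU`; `B` is the stabiliser of the isotropic line `K e₀`).  The standard apartment is the bi-infinite path `A : ℤ → 𝓥` (HYPOTHESIS-STYLE `(A, hA0, hA1)` exactly as in
★ `UnitaryLatticeTreeGeodesicApartment` §Enum, supplied by ★ `exists_apartmentEnum`): `A (2a) = latt diag(ϖ^a, 1, ϖ^{-a})` (self-dual), `A (2a+1) = latt diag(ϖ^{a+1}, 1, ϖ^{-a})`
(type two).  Cell `pub/hodgecm-mathlib` (D-0151), crux H413 = `stmt-HodgeConjecture-24833`, lane `--supports`; E1 BRICK LEDGER row 55 «HOROCYCLE ∕ HEIGHT GEOMETRY OF THE `U(3)` TREE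
AT THE DATUM» (keeper F0P3a-p03 (g30) 03:20:54Z), file A-I «HOROCYCLE STEPS» of `CENSUS-R55.v1` (c3e3dfd81a9bbf59; the missing brick H «the `N`-orbits are the horospheres and the
standard apartment is a transversal», heads (T)(T′)(H1)–(H4); (H5)–(H8) = file A-II `UnitaryLatticeTreeHorosphereTransversal`, LH5-p05 (g12)), cut in three by the 400-line rule:
A-I-1 `…HorocycleRootStar` ((T)(T′)(H2)), A-I-2 `…HorocycleTypeTwoStar` ((H3)), A-I-3 `…HorocycleSteps` ((H1)(H4), the head).  Topic `NumberTheory/Automorphic`; namespace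
`Literature.NumberTheory.Automorphic.UnitaryLatticeTree`.  THEOREMS ONLY (no definition, no instance, no notation, no named fact, no `sorry`).
HONEST LABEL: count-neutral generic lattice-tree layer at an UNRAMIFIED datum `hd : UnramifiedLocalConjDatum σ ϖ` ((R-SS) banked as a PAYDOWN-UNR road for K1 only; E1 =
PRINT); HC_CM is proved only modulo the 7 printed citations (2 remaining named inputs hLiu418 = `stmt-HodgeConjecture-24832`, h413 = `stmt-HodgeConjecture-24833`) until rung 0
closes; nothing printed is asserted here — elementary lattice algebra over a valued field.

THIS FILE.  **(H3)** `exists_mem_unipotentU_apply_apartmentEnum_zero_eq_of_adj_neg_one`: a neighbour `y ≠ A (−2) = latt diag(ϖ⁻¹,1,ϖ)` of `A (−1) = N₁ = latt diag(1,1,ϖ)` is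
`n · A 0` for some `n ∈ N` fixing `A (−1)`.  By ★ V3 `y = N₁ + 𝒪 w(a,b)`, `w(a,b) = (a∕ϖ, 0, b)`, `(a, b)` primitive and residually isotropic (`σ(a)b + σ(b)a ∈ 𝔪`): `|a| < 1` gives
`y = A 0` (`n = 1`), `|a| = 1 > |b|` gives `y = A (−2)`, and for `|a| = |b| = 1` the trace element of `hd` (`t + σ t = 1`) corrects `a∕b` to a trace-zero `z ≡ a∕b (mod 𝔪)`; then
`n = u(0, z∕ϖ)` is unitary, fixes `N₁`, and maps `𝒪³` onto `N₁ + 𝒪 (z∕ϖ, 0, 1) = N₁ + 𝒪 w(a,b)`.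

## References
* [BruhatTits1972] F. Bruhat, J. Tits, *Groupes réductifs sur un corps local I*, Publ. Math. IHÉS 41 (1972), §10 (lattice models of the rank-one unitary building), (4.4.4)
  (the stabiliser of a vertex is transitive on the chambers containing it), (7.4.18).
* [Serre1980Trees] J.-P. Serre, *Trees* (1980), Ch. II §1.1 (the tree of `SL₂`: lattices, the apartment of diagonal lattices, the action of unipotent matrices), Ch. I §2.
* [Rogawski1990] J. D. Rogawski, *Automorphic Representations of Unitary Groups in Three Variables*, Ann. of Math. Stud. 123 (1990), §1.10 p. 9 (`B = MN`, `N = {u(x, z)}`,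
  `d(α, β, ᾱ⁻¹)`), §4.5 p. 45 (Iwasawa decomposition).
-/

set_option autoImplicit false

open scoped Valued WithZero Matrix MatrixGroups

namespace Literature.NumberTheory.Automorphic.UnitaryLatticeTree

open _root_.SimpleGraph Literature.NumberTheory.Automorphic Literature.NumberTheory.Automorphic.HermitianLattice
open Literature.NumberTheory.Automorphic.CartanUnique (uniformizer_ne_zero uniformizer_mem_integer)
open Literature.NumberTheory.Automorphic.UnitaryGroup

variable {K : Type*} [Field K] [Valued K ℤᵐ⁰] {σ : K →+* K} {ϖ : K}
section Enum

variable (hd : UnramifiedLocalConjDatum σ ϖ)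
  (A : ℤ → {M : Submodule 𝒪[K] (Fin 3 → K) // IsVertex σ ϖ ((StdForm.antidiagonal 3).over K) M})
  (hA0 : ∀ a : ℤ, (A (2 * a)).1 = latt (Matrix.diagonal ![ϖ ^ a, (1 : K), ϖ ^ (-a)]))
  (hA1 : ∀ a : ℤ, (A (2 * a + 1)).1 = latt (Matrix.diagonal ![ϖ ^ (a + 1), (1 : K), ϖ ^ (-a)]))
include hd hA0 hA1

omit hd hA0 hA1 in
/-- `|p q| ≤ r` for `|p| ≤ 1`, `|q| ≤ r` (local copy of ★ `UnitaryGroup.v_mul_le_of_le_one_of_le`, kept private to spare the import). [cite: Serre1980Trees, II.1.1] -/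
private theorem v_mul_le_of_le_one_of_le {p q : K} {r : ℤᵐ⁰} (hp : Valued.v p ≤ 1) (hq : Valued.v q ≤ r) : Valued.v (p * q) ≤ r := by
  rw [map_mul]; exact (mul_le_mul' hp hq).trans_eq (one_mul r)

/-! ## §3 The type-two star as one horocycle step: `star(A (−1)) = {A (−2)} ⊔ (N ∩ Stab(A (−1))) · A 0` -/

/-- **THE TYPE-TWO STAR AS ONE HOROCYCLE STEP**: a neighbour `y` of `A (−1) = N₁ = latt diag(1,1,ϖ)` other than `A (−2) = latt diag(ϖ⁻¹,1,ϖ)` is `n · A 0` for a unipotent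
upper-triangular `n ∈ N` fixing `A (−1)`.  By ★ V3 `y = N₁ + 𝒪 w(a,b)`, `w(a,b) = (a∕ϖ, 0, b)`, `(a, b)` primitive and residually isotropic (`σ(a)b + σ(b)a ∈ 𝔪`): `|a| < 1` gives `y = A 0`
(`n = 1`), `|a| = 1 > |b|` gives `y = A (−2)`, and for `|a| = |b| = 1` the trace element of `hd` corrects `a∕b` to a trace-zero `z ≡ a∕b (mod 𝔪)`, and `n = u(0, z∕ϖ)` maps `𝒪³` to
`N₁ + 𝒪 (z∕ϖ, 0, 1) = N₁ + 𝒪 w(a,b)` and fixes `N₁`. [cite: BruhatTits1972, (4.4.4) and §10] [cite: Serre1980Trees, II.1.1] [cite: Rogawski1990, §1.10 p. 9] -/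
theorem exists_mem_unipotentU_apply_apartmentEnum_zero_eq_of_adj_neg_one
    {y : {M : Submodule 𝒪[K] (Fin 3 → K) // IsVertex σ ϖ ((StdForm.antidiagonal 3).over K) M}}
    (hy : (latticeGraph σ ϖ ((StdForm.antidiagonal 3).over K)).Adj (A (-1)) y) (hy' : y ≠ A (-2)) :
    ∃ n : unitaryGroupOfForm σ ((StdForm.antidiagonal 3).over K), n ∈ unipotentU σ ((StdForm.antidiagonal 3).over K) ∧
      latticeGraphIso σ ϖ ((StdForm.antidiagonal 3).over K) n (A (-1)) = A (-1) ∧ latticeGraphIso σ ϖ ((StdForm.antidiagonal 3).over K) n (A 0) = y := by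
  have hϖ0 : ϖ ≠ 0 := uniformizer_ne_zero hd.vϖ
  have hϖ1 : Valued.v ϖ ≤ 1 := v_le_one_of_v_eq_exp_neg_one hd.vϖ
  have hvϖ0 : Valued.v ϖ ≠ 0 := (Valuation.ne_zero_iff _).2 hϖ0
  have hlt1 : ∀ z : K, Valued.v z < 1 ↔ Valued.v z ≤ Valued.v ϖ := fun z => by rw [hd.vϖ]; exact v_lt_one_iff z
  have hA0' : (A 0).1 = stdLattice K 3 := coe_apartmentEnum_zero A hA0
  have hAm1 : (A (-1)).1 = latt (Matrix.diagonal ![(1 : K), 1, ϖ]) := by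
    have h := hA1 (-1)
    rw [show (2 : ℤ) * (-1) + 1 = -1 by norm_num, show (-1 : ℤ) + 1 = 0 by norm_num, neg_neg, zpow_zero, zpow_one] at h
    exact h
  have hAm2 : (A (-2)).1 = latt (Matrix.diagonal ![ϖ⁻¹, (1 : K), ϖ]) := by
    have h := hA0 (-1)
    rw [show (2 : ℤ) * (-1) = -2 by norm_num, neg_neg, zpow_neg, zpow_one] at h
    exact h
  have hd1 : ∀ i, (![(1 : K), 1, ϖ] : Fin 3 → K) i ≠ 0 := by intro i; fin_cases i <;> simp [hϖ0]
  have hstd : ∀ x' : Fin 3 → K, x' ∈ stdLattice K 3 ↔ ∀ i, Valued.v (x' i) ≤ 1 := fun x' => Iff.rfl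
  have hN₁ : ∀ x' : Fin 3 → K, x' ∈ latt (Matrix.diagonal ![(1 : K), 1, ϖ]) ↔ Valued.v (x' 0) ≤ 1 ∧ Valued.v (x' 1) ≤ 1 ∧ Valued.v (x' 2) ≤ Valued.v ϖ := fun x' => by
    rw [mem_latt_diagonal_iff hd1, Fin.forall_fin_succ, Fin.forall_fin_two]
    simp only [Fin.succ_zero_eq_one, Fin.succ_one_eq_two, Matrix.cons_val_zero, Matrix.cons_val_one, Matrix.cons_val_two, Matrix.tail_cons, Matrix.head_cons, map_one]
  -- ★ V3: `y = N₁ + 𝒪 w(a,b)`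
  have hroot : A (-1) = ⟨latt (Matrix.diagonal ![(1 : K), 1, ϖ]), 2,
      isVertexLattice_two_latt_diagonal_one_one hd.σϖ (uniformizer_mem_integer hd.vϖ) (uniformizer_ne_zero hd.vϖ)⟩ := Subtype.ext hAm1
  have hw : y ∈ (latticeGraph σ ϖ ((StdForm.antidiagonal 3).over K)).neighborSet ⟨latt (Matrix.diagonal ![(1 : K), 1, ϖ]), 2,
      isVertexLattice_two_latt_diagonal_one_one hd.σϖ (uniformizer_mem_integer hd.vϖ) (uniformizer_ne_zero hd.vϖ)⟩ := by
    rw [SimpleGraph.mem_neighborSet, ← hroot]; exact hy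
  obtain ⟨a, b, ha, hb, hprim, hiso, hyab⟩ := (mem_neighborSet_N₁_iff_exists_vec hd y).1 hw
  by_cases hva : Valued.v a < 1
  · -- `|a| < 1`: `y = A 0`, take `n = 1`
    have hvb : Valued.v b = 1 := hprim.resolve_left hva.ne
    have hb0 : b ≠ 0 := fun h => by rw [h, map_zero] at hvb; exact zero_ne_one hvb
    refine ⟨1, Subgroup.one_mem _, latticeGraphIso_one_apply _, ?_⟩
    rw [latticeGraphIso_one_apply]
    apply Subtype.ext
    rw [hA0', hyab]
    apply le_antisymm
    · -- `𝒪³ ≤ N₁ + 𝒪w`: `x = (x − (x₂∕b)·w) + (x₂∕b)·w`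
      intro x' hx'
      have hi : ∀ i, Valued.v (x' i) ≤ 1 := hx'
      refine mem_sup_span_singleton_of_sub_smul_mem (x' 2 / b) (by rw [map_div₀, hvb, div_one]; exact hi 2) ((hN₁ _).2 ⟨?_, ?_, ?_⟩)
      · simp only [Pi.sub_apply, Pi.smul_apply, smul_eq_mul, Matrix.cons_val_zero]
        refine v_sub_le_one_of_le (hi 0) ?_
        rw [map_mul, map_div₀, map_div₀, hvb, div_one]
        calc Valued.v (x' 2) * (Valued.v a / Valued.v ϖ) ≤ 1 * 1 :=
              mul_le_mul' (hi 2) ((div_le_one₀ (zero_lt_iff.2 hvϖ0)).2 ((hlt1 a).1 hva))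
          _ = 1 := one_mul 1
      · simp only [Pi.sub_apply, Pi.smul_apply, smul_eq_mul, Matrix.cons_val_one, Matrix.cons_val_zero, mul_zero, sub_zero]; exact hi 1
      · simp only [Pi.sub_apply, Pi.smul_apply, smul_eq_mul, Matrix.cons_val_two, Matrix.tail_cons, Matrix.head_cons]
        rw [div_mul_cancel₀ _ hb0, sub_self, map_zero]; exact zero_le
    · refine sup_le (fun x' hx' => ?_) (span_singleton_le_of_mem ?_)
      · obtain ⟨h0, h1, h2⟩ := (hN₁ x').1 hx'
        intro i; fin_cases i
        · exact h0
        · exact h1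
        · exact h2.trans hϖ1
      · intro i; fin_cases i
        · change Valued.v (a / ϖ) ≤ 1; rw [map_div₀, div_le_one₀ (zero_lt_iff.2 hvϖ0)]; exact (hlt1 a).1 hva
        · change Valued.v (0 : K) ≤ 1; rw [map_zero]; exact zero_le
        · exact hb
  · have hva1 : Valued.v a = 1 := le_antisymm ha (not_lt.1 hva)
    have ha0 : a ≠ 0 := fun h => by rw [h, map_zero] at hva1; exact zero_ne_one hva1
    by_cases hvb : Valued.v b < 1
    · -- `|a| = 1 > |b|`: `y = A (−2)`, excluded
      exfalso; apply hy'
      apply Subtype.ext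
      rw [hAm2, hyab]
      have hd2 : ∀ i, (![ϖ⁻¹, (1 : K), ϖ] : Fin 3 → K) i ≠ 0 := by intro i; fin_cases i <;> simp [hϖ0]
      have hL : ∀ x' : Fin 3 → K, x' ∈ latt (Matrix.diagonal ![ϖ⁻¹, (1 : K), ϖ]) ↔
          Valued.v (x' 0) ≤ (Valued.v ϖ)⁻¹ ∧ Valued.v (x' 1) ≤ 1 ∧ Valued.v (x' 2) ≤ Valued.v ϖ := fun x' => by
        rw [mem_latt_diagonal_iff hd2, Fin.forall_fin_succ, Fin.forall_fin_two]
        simp only [Fin.succ_zero_eq_one, Fin.succ_one_eq_two, Matrix.cons_val_zero, Matrix.cons_val_one, Matrix.cons_val_two, Matrix.tail_cons, Matrix.head_cons,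
          map_one, map_inv₀]
      have h1inv : (1 : ℤᵐ⁰) ≤ (Valued.v ϖ)⁻¹ := one_le_inv_iff₀.2 ⟨zero_lt_iff.2 hvϖ0, hϖ1⟩
      apply le_antisymm
      · refine sup_le (fun x' hx' => ?_) (span_singleton_le_of_mem ?_)
        · obtain ⟨h0, h1, h2⟩ := (hN₁ x').1 hx'
          exact (hL x').2 ⟨h0.trans h1inv, h1, h2⟩
        · refine (hL _).2 ⟨?_, ?_, ?_⟩
          · simp only [Matrix.cons_val_zero]; rw [map_div₀, hva1, one_div]
          · simp
          · simpa using (hlt1 b).1 hvb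
      · -- `latt diag(ϖ⁻¹,1,ϖ) ≤ N₁ + 𝒪w`: `x = (x − (x₀ϖ∕a)·w) + (x₀ϖ∕a)·w`
        intro x' hx'
        obtain ⟨h0, h1, h2⟩ := (hL x').1 hx'
        have hr : Valued.v (x' 0 * ϖ / a) ≤ 1 := by
          rw [map_div₀, map_mul, hva1, div_one]
          calc Valued.v (x' 0) * Valued.v ϖ ≤ (Valued.v ϖ)⁻¹ * Valued.v ϖ := mul_le_mul_left h0 _
            _ = 1 := inv_mul_cancel₀ hvϖ0
        refine mem_sup_span_singleton_of_sub_smul_mem (x' 0 * ϖ / a) hr ((hN₁ _).2 ⟨?_, ?_, ?_⟩)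
        · simp only [Pi.sub_apply, Pi.smul_apply, smul_eq_mul, Matrix.cons_val_zero]
          rw [show x' 0 - x' 0 * ϖ / a * (a / ϖ) = 0 by field_simp; ring, map_zero]; exact zero_le
        · simp only [Pi.sub_apply, Pi.smul_apply, smul_eq_mul, Matrix.cons_val_one, Matrix.cons_val_zero, mul_zero, sub_zero]; exact h1
        · simp only [Pi.sub_apply, Pi.smul_apply, smul_eq_mul, Matrix.cons_val_two, Matrix.tail_cons, Matrix.head_cons]
          refine (Valuation.map_sub _ _ _).trans (max_le h2 ?_)
          exact v_mul_le_of_le_one_of_le hr ((hlt1 b).1 hvb)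
    · -- `|a| = |b| = 1`: the Heisenberg element `u(0, z∕ϖ)`, `z ≡ a∕b`, `z + σ z = 0`
      have hvb1 : Valued.v b = 1 := le_antisymm hb (not_lt.1 hvb)
      have hb0 : b ≠ 0 := fun h => by rw [h, map_zero] at hvb1; exact zero_ne_one hvb1
      have hσb0 : σ b ≠ 0 := (map_ne_zero σ).2 hb0
      -- the trace defect `s = a∕b + σ(a∕b) ∈ 𝔪`
      set s : K := a / b + σ (a / b) with hs
      have hsσ : σ s = s := by rw [hs, map_add, hd.σσ, add_comm]
      have hvs : Valued.v s < 1 := by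
        have e : s = (σ a * b + σ b * a) / (σ b * b) := by rw [hs, map_div₀]; field_simp; ring
        rw [e, map_div₀, map_mul, hd.vσ, hvb1, one_mul, div_one]; exact hiso
      obtain ⟨t, ht1, htr⟩ := hd.trace
      set z : K := a / b - s * t with hz
      have hzσ : z + σ z = 0 := by
        have e : z + σ z = (a / b + σ (a / b)) - s * (t + σ t) := by rw [hz, map_sub, map_mul, hsσ]; ring
        rw [e, htr, mul_one, ← hs, sub_self]
      have hvab : Valued.v (a / b) = 1 := by rw [map_div₀, hva1, hvb1, div_one]
      have hvst : Valued.v (s * t) ≤ Valued.v ϖ := (v_mul_le_of_le_one_of_le ht1 ((hlt1 s).1 hvs)).trans_eq' (by rw [mul_comm])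
      have hvz : Valued.v z ≤ 1 := by rw [hz]; exact v_sub_le_one_of_le hvab.le (hvst.trans hϖ1)
      have hvzϖ : Valued.v (z / ϖ) ≤ (Valued.v ϖ)⁻¹ := by rw [map_div₀, div_eq_mul_inv]; exact mul_le_of_le_one_left' hvz
      -- the element
      let nM : Matrix (Fin 3) (Fin 3) K := !![1, 0, z / ϖ; 0, 1, 0; 0, 0, 1]
      let nMi : Matrix (Fin 3) (Fin 3) K := !![1, 0, -(z / ϖ); 0, 1, 0; 0, 0, 1]
      have hmul : nM * nMi = 1 := by
        ext i j; fin_cases i <;> fin_cases j <;> simp [nM, nMi, Matrix.mul_apply, Fin.sum_univ_three]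
      have hmul' : nMi * nM = 1 := by
        ext i j; fin_cases i <;> fin_cases j <;> simp [nM, nMi, Matrix.mul_apply, Fin.sum_univ_three]
      let nG : GL (Fin 3) K := ⟨nM, nMi, hmul, hmul'⟩
      have hnU : nG ∈ unitaryGroupOfForm σ ((StdForm.antidiagonal 3).over K) := by
        refine (mem_unitaryGroupOfForm_iff_of_coe_eq_upperUnipotent σ hd.σσ (a := 0) (b := z / ϖ) (c := 0) (u := nG) rfl).2 ⟨by rw [map_zero, neg_zero], ?_⟩
        rw [map_zero, mul_zero, add_zero, map_div₀, hd.σϖ, ← add_div, hzσ, zero_div]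
      -- how `n⁻¹` acts on coordinates
      have hact : ∀ x' : Fin 3 → K, nMi.mulVec x' 0 = x' 0 - z / ϖ * x' 2 ∧ nMi.mulVec x' 1 = x' 1 ∧ nMi.mulVec x' 2 = x' 2 := fun x' => by
        obtain ⟨e0, e1, e2⟩ := upperUnipotent_mulVec (0 : K) (-(z / ϖ)) 0 x'
        refine ⟨?_, ?_, e2⟩
        · change (!![1, 0, -(z / ϖ); 0, 1, 0; 0, 0, 1] : Matrix (Fin 3) (Fin 3) K).mulVec x' 0 = _; rw [e0]; ring
        · change (!![1, 0, -(z / ϖ); 0, 1, 0; 0, 0, 1] : Matrix (Fin 3) (Fin 3) K).mulVec x' 1 = _; rw [e1]; ring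
      -- `|z∕ϖ · x₂| ≤ 1` when `|x₂| ≤ |ϖ|`
      have hzx : ∀ q : K, Valued.v q ≤ Valued.v ϖ → Valued.v (z / ϖ * q) ≤ 1 := fun q hq => by
        rw [map_mul]
        calc Valued.v (z / ϖ) * Valued.v q ≤ (Valued.v ϖ)⁻¹ * Valued.v ϖ := mul_le_mul' hvzϖ hq
          _ = 1 := inv_mul_cancel₀ hvϖ0
      refine ⟨⟨nG, hnU⟩, ?_, ?_, ?_⟩
      · rw [mem_unipotentU_iff]
        refine ⟨?_, fun i => ?_⟩
        · intro i j hij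
          change (j : Fin 3) < i at hij
          change nM i j = 0
          fin_cases i <;> fin_cases j <;> simp [nM] at hij ⊢
        · change nM i i = 1
          fin_cases i <;> simp [nM]
      · -- `n` fixes `N₁`
        apply Subtype.ext
        change mapGL nG (A (-1)).1 = (A (-1)).1
        rw [hAm1]
        ext x'
        rw [mem_mapGL_iff]
        change nMi.mulVec x' ∈ latt (Matrix.diagonal ![(1 : K), 1, ϖ]) ↔ _
        obtain ⟨e0, e1, e2⟩ := hact x'
        rw [hN₁, hN₁, e0, e1, e2]
        constructor
        · rintro ⟨h0, h1, h2⟩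
          refine ⟨?_, h1, h2⟩
          rw [show x' 0 = (x' 0 - z / ϖ * x' 2) + z / ϖ * x' 2 by ring]
          exact v_add_le_one_of_le h0 (hzx _ h2)
        · rintro ⟨h0, h1, h2⟩
          exact ⟨v_sub_le_one_of_le h0 (hzx _ h2), h1, h2⟩
      · -- `n · 𝒪³ = N₁ + 𝒪 w(a,b)`
        apply Subtype.ext
        change mapGL nG (A 0).1 = y.1
        rw [hA0', hyab]
        apply le_antisymm
        · intro x' hx'
          rw [mem_mapGL_iff] at hx'
          change nMi.mulVec x' ∈ stdLattice K 3 at hx'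
          have hi : ∀ i, Valued.v (nMi.mulVec x' i) ≤ 1 := hx'
          obtain ⟨e0, e1, e2⟩ := hact x'
          have h0 := hi 0; have h1 := hi 1; have h2 := hi 2
          rw [e0] at h0; rw [e1] at h1; rw [e2] at h2
          refine mem_sup_span_singleton_of_sub_smul_mem (x' 2 / b) (by rw [map_div₀, hvb1, div_one]; exact h2) ((hN₁ _).2 ⟨?_, ?_, ?_⟩)
          · simp only [Pi.sub_apply, Pi.smul_apply, smul_eq_mul, Matrix.cons_val_zero]
            have e : x' 0 - x' 2 / b * (a / ϖ) = (x' 0 - z / ϖ * x' 2) - x' 2 * (s * t) / ϖ := by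
              rw [hz]; field_simp; ring
            rw [e]
            refine v_sub_le_one_of_le h0 ?_
            rw [map_div₀, map_mul, div_le_one₀ (zero_lt_iff.2 hvϖ0)]
            exact v_mul_le_of_le_one_of_le h2 hvst |>.trans_eq' (by rw [map_mul])
          · simp only [Pi.sub_apply, Pi.smul_apply, smul_eq_mul, Matrix.cons_val_one, Matrix.cons_val_zero, mul_zero, sub_zero]; exact h1
          · simp only [Pi.sub_apply, Pi.smul_apply, smul_eq_mul, Matrix.cons_val_two, Matrix.tail_cons, Matrix.head_cons]
            rw [div_mul_cancel₀ _ hb0, sub_self, map_zero]; exact zero_le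
        · refine sup_le (fun x' hx' => ?_) (span_singleton_le_of_mem ?_)
          · obtain ⟨h0, h1, h2⟩ := (hN₁ x').1 hx'
            rw [mem_mapGL_iff]
            change nMi.mulVec x' ∈ stdLattice K 3
            obtain ⟨e0, e1, e2⟩ := hact x'
            intro i; fin_cases i
            · change Valued.v (nMi.mulVec x' 0) ≤ 1; rw [e0]; exact v_sub_le_one_of_le h0 (hzx _ h2)
            · change Valued.v (nMi.mulVec x' 1) ≤ 1; rw [e1]; exact h1
            · change Valued.v (nMi.mulVec x' 2) ≤ 1; rw [e2]; exact h2.trans hϖ1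
          · rw [mem_mapGL_iff]
            change nMi.mulVec ![a / ϖ, 0, b] ∈ stdLattice K 3
            obtain ⟨e0, e1, e2⟩ := hact ![a / ϖ, 0, b]
            intro i; fin_cases i
            · change Valued.v (nMi.mulVec ![a / ϖ, 0, b] 0) ≤ 1
              rw [e0]
              simp only [Matrix.cons_val_zero, Matrix.cons_val_two, Matrix.tail_cons, Matrix.head_cons]
              have e : a / ϖ - z / ϖ * b = b * (s * t) / ϖ := by rw [hz]; field_simp; ring
              rw [e, map_div₀, div_le_one₀ (zero_lt_iff.2 hvϖ0)]
              exact v_mul_le_of_le_one_of_le hb hvst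
            · change Valued.v (nMi.mulVec ![a / ϖ, 0, b] 1) ≤ 1; rw [e1]; simp
            · change Valued.v (nMi.mulVec ![a / ϖ, 0, b] 2) ≤ 1; rw [e2]; simpa using hb

end Enum

end Literature.NumberTheory.Automorphic.UnitaryLatticeTree
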